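import Summits.KontsevichZagierPeriods.KontsevichZagierPeriods.Theses.HodgeColevel

/-!
# `TargetOfCores` (stmt-KontsevichZagierPeriods-14209, route HodgeColevel) — proof

`TargetOfCores : DegreeCompression → SameDegreeConjecture → Target` (route-choice hold 2026-08-16,
option (a): make the rank-0 target reachable from the two open cores). The target `X` of route
HodgeColevel is LITERALLY the conjunction of its two cruxes — `DegreeCompression` (equal values of
rational representations ⇒ the same dimensions are reachable by moves) and `SameDegreeConjecture`
(two incompressible `d`-dimensional representations of equal value are KZ-equivalent) — so the proof
is the anonymous constructor. Pure logic over the route's own definitions, no new definitions;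
planner-proved glue (item docstring: `fun hC hS => ⟨hC, hS⟩`), landed by lead c10 of crux
stmt-KontsevichZagierPeriods-9129 (banking). Source: M. Kontsevich, D. Zagier, *Periods* (2001),
§1.2 (Conjecture 1, Problem 2).
-/

namespace Summit.KontsevichZagierPeriods.HodgeColevel

/-- **`TargetOfCores`** (route HodgeColevel, stmt-KontsevichZagierPeriods-14209):
`DegreeCompression → SameDegreeConjecture → Target`, where `Target` is verbatim the conjunction
`DegreeCompression ∧ SameDegreeConjecture`; proof = pairing the two hypotheses. [folklore] -/
theorem targetOfCores_proof :
    Summit.KontsevichZagierPeriods.KontsevichZagierPeriods.Theses.HodgeColevel.TargetOfCores :=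
  fun hC hS => ⟨hC, hS⟩

end Summit.KontsevichZagierPeriods.HodgeColevel
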